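import Summits.AtomisticToContinuum.BoseEinsteinCondensation.Theorems.BECThomsonPrincipleFibreConductanceConditionalDefs
import Summits.AtomisticToContinuum.BoseEinsteinCondensation.Theorems.BECThomsonPrincipleFibreConductanceStubConditionalDensityMomentsFree
import Literature.MathematicalPhysics.QuantumManyBody.PeriodicBoseGasLemma33
import HarnessLib

/-!
# Route `BECThomsonPrinciple`, crux `FibreConductance` (stmt-AtomisticToContinuum-9480),
# line `conditional-law-poincare` — THE FREE-GAS INSTANCE OF THE COARSE BEAT CHARGE

Helper towards the OPEN stub `stub_coarseBeatDual` (`CoarseBeatDualBound` of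
`BECThomsonPrincipleFibreConductanceConditionalDefs`): at `v = 0` the coarse beat charge
`q_c = ψ²·c_Q/μ_Q` of the WAVELENGTH tiling (`‖n‖_∞` cubes per axis, side `ℓ = L/‖n‖_∞`) VANISHES
identically on the cell, so its dual bound there is `0` — the stub is pure interaction content.

* `coarseOf_cruxCharge_eq_zero_of_free`: for a free exact minimiser `Φ`
  (`periodicEnergy 0 Φ = E₀^per(0)`), `n ≠ 0` and `X ∈ cellN`,
  `coarseOf L (waveBlocks n) Φ (cruxCharge n Φ) X = 0`;
* `hasDualBound_coarse_free`: hence `HasDualBound Φ (coarseOf L (waveBlocks n) Φ (cruxCharge n Φ)) 0`.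

Proof. Free exact minimisers are constant on the cell (gen 1's `exists_eqOn_const_of_freeMinimiser`),
so the conditional amplitude is `ψ ≡ L^{-3/2}` on `cellN` (`condDensity_of_eqOn_const`, `ψ > 0`), the
mode `β = L^{-3/2}∫_cell e^{ik·y} dy` vanishes for `n ≠ 0` (`integral_cell_cellWave_eq_zero`), and on the
fibre through `X ∈ cellN` the charge is `q(y) = L⁻³e^{ik·y}`. Its total charge on a tiling cube is
`c_Q = L⁻³∫_Q e^{ik·y} dy = 0` by COMMENSURABILITY (`cfg_setIntegral_cubeSet_phase_eq_zero`): the cube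
is a product box, the integral factorises over the three axes
(`MeasureTheory.integral_fintype_prod_eq_prod` after transport to `Fin 3 → ℝ`), and along an axis `j`
with `|n_j| = ‖n‖_∞` the cube spans exactly `|n_j|ℓ/L = 1` period of `t ↦ e^{2πi n_j t/L}`, whose
integral vanishes (`integral_exp_mul_complex`, `Complex.exp_int_mul_two_pi_mul_I`). Hence
`q_c = ψ²·0/μ_Q = 0` pointwise on `cellN`, and the pairing `∫_{cellN} q_c η` is `0` for every test `η`.

All [folklore] (elementary calculus over the landed vocabulary).
-/

noncomputable section

namespace Summit.AtomisticToContinuum.BoseEinsteinCondensation.Cruxes.FibreConductance.ConditionalLawPoincare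

open MeasureTheory Set
open scoped ENNReal
open Literature.MathematicalPhysics.QuantumManyBody.BoseGas
open Summit.AtomisticToContinuum.BoseEinsteinCondensation.Cruxes.FibreConductance.ParsevalShellBootstrap
open Summit.AtomisticToContinuum.BoseEinsteinCondensation.Cruxes.FibreConductance.HealingSplitKineticDefect
open Summit.AtomisticToContinuum.BoseEinsteinCondensation.Cruxes.FibreConductance.TaggedPathHarnack
  (exists_eqOn_const_of_freeMinimiser update_mem_cellN condDensity_of_eqOn_const)

variable {m : ℕ} {L : ℝ}

/-! ### Commensurability: a plane wave integrates to zero over a cube spanning whole periods -/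

/-- The plane wave `e^{ik·y}` is the product of the one-dimensional exponentials `e^{2πi n_l y_l/L}`
(coordinates on `Fin 3 → ℝ`). [folklore] -/
theorem cfg_phase_toLp (L : ℝ) (n : Fin 3 → ℤ) (z : Fin 3 → ℝ) :
    phase L n (WithLp.toLp 2 z) =
      ∏ l, Complex.exp (2 * Real.pi * Complex.I * (n l : ℂ) / L * (z l : ℂ)) := by
  rw [phase, ← Complex.exp_sum]
  congr 1
  push_cast
  simp only [Finset.mul_sum]
  exact Finset.sum_congr rfl fun l _ => by ring

/-- ONE FULL PERIOD: `∫_{[a, a+ℓ)} e^{2πi n_j t/L} dt = 0` when `n_j ≠ 0` and `(ν+1) ∣ n_j`,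
`ℓ = L/(ν+1)` (so that `n_j ℓ/L ∈ ℤ`): the antiderivative `e^{2πi n_j t/L}·L/(2πi n_j)` takes the same
value at both ends. [folklore] -/
theorem cfg_integral_Ico_exp_eq_zero (hL : 0 < L) {ν : ℕ} {nj : ℤ} (hj : nj ≠ 0)
    (hdvd : ((ν + 1 : ℕ) : ℤ) ∣ nj) (a : ℝ) :
    ∫ t in Ico a (a + side L ν), Complex.exp (2 * Real.pi * Complex.I * (nj : ℂ) / L * (t : ℂ)) = 0 := by
  obtain ⟨k, hk⟩ := hdvd
  have hs := side_pos hL ν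
  have hL0 : (L : ℂ) ≠ 0 := by exact_mod_cast hL.ne'
  have hν : ((ν : ℂ) + 1) ≠ 0 := Nat.cast_add_one_ne_zero ν
  have hc : (2 * Real.pi * Complex.I * (nj : ℂ) / L : ℂ) ≠ 0 := by
    have h1 : (nj : ℂ) ≠ 0 := by exact_mod_cast hj
    have h3 : (Real.pi : ℂ) ≠ 0 := by exact_mod_cast Real.pi_ne_zero
    exact div_ne_zero (mul_ne_zero (mul_ne_zero (mul_ne_zero two_ne_zero h3) Complex.I_ne_zero) h1) hL0
  have hkey : 2 * Real.pi * Complex.I * (nj : ℂ) / L * ((a + side L ν : ℝ) : ℂ) =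
      2 * Real.pi * Complex.I * (nj : ℂ) / L * (a : ℂ) + k * (2 * Real.pi * Complex.I) := by
    have hk' : ((nj : ℤ) : ℂ) = ((ν : ℂ) + 1) * (k : ℂ) := by rw [hk]; push_cast; ring
    rw [hk']
    simp only [side]
    push_cast
    field_simp
  rw [integral_Ico_eq_integral_Ioc, ← intervalIntegral.integral_of_le (by linarith),
    integral_exp_mul_complex hc, hkey, Complex.exp_add, Complex.exp_int_mul_two_pi_mul_I, mul_one,
    sub_self, zero_div]

/-- **COMMENSURABILITY.** The plane wave `e^{ik·y}`, `k = 2πn/L`, integrates to zero over every cube of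
the tiling with block count `ν` as soon as `(ν+1) ∣ n_j ≠ 0` along some axis `j`: the cube is a
product box, the integral factorises over the axes, and the `j`-th factor is an integral over whole
periods. [folklore] -/
theorem cfg_setIntegral_cubeSet_phase_eq_zero (hL : 0 < L) {ν : ℕ} {n : Fin 3 → ℤ} {j : Fin 3}
    (hj : n j ≠ 0) (hdvd : ((ν + 1 : ℕ) : ℤ) ∣ n j) (Q : Fin 3 → Fin (ν + 1)) :
    ∫ y in cubeSet L ν Q, phase L n y = 0 := by
  -- adapted from `integral_cell_fderiv_eq_zero` (PeriodicBoseGasFourier.lean) and `volume_cell`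
  have hpre : (WithLp.toLp 2) ⁻¹' cubeSet L ν Q =
      Set.univ.pi fun l => Ico (((Q l : ℕ) : ℝ) * side L ν) ((((Q l : ℕ) : ℝ) + 1) * side L ν) := by
    ext z; simp [cubeSet]
  have hb : (((Q j : ℕ) : ℝ) + 1) * side L ν = ((Q j : ℕ) : ℝ) * side L ν + side L ν := by ring
  calc ∫ y in cubeSet L ν Q, phase L n y
      = ∫ z in (WithLp.toLp 2) ⁻¹' cubeSet L ν Q, phase L n (WithLp.toLp 2 z) :=
        ((PiLp.volume_preserving_toLp (Fin 3)).setIntegral_preimage_emb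
          (MeasurableEquiv.toLp 2 (Fin 3 → ℝ)).measurableEmbedding (phase L n) (cubeSet L ν Q)).symm
    _ = ∫ z, ∏ l, Complex.exp (2 * Real.pi * Complex.I * (n l : ℂ) / L * ((z l : ℝ) : ℂ))
          ∂Measure.pi fun l => (volume : Measure ℝ).restrict
            (Ico (((Q l : ℕ) : ℝ) * side L ν) ((((Q l : ℕ) : ℝ) + 1) * side L ν)) := by
        rw [hpre, volume_pi, Measure.restrict_pi_pi]
        simp_rw [cfg_phase_toLp]
    _ = ∏ l, ∫ t in Ico (((Q l : ℕ) : ℝ) * side L ν) ((((Q l : ℕ) : ℝ) + 1) * side L ν),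
          Complex.exp (2 * Real.pi * Complex.I * (n l : ℂ) / L * (t : ℂ)) :=
        integral_fintype_prod_eq_prod (𝕜 := ℂ)
          (fun (l : Fin 3) (t : ℝ) => Complex.exp (2 * Real.pi * Complex.I * (n l : ℂ) / L * (t : ℂ)))
    _ = 0 := Finset.prod_eq_zero (Finset.mem_univ j)
        (by rw [hb]; exact cfg_integral_Ico_exp_eq_zero hL hj hdvd _)

/-- For `n ≠ 0` some axis `j` has `|n_j| = ‖n‖_∞ = waveBlocks n + 1`, hence
`(waveBlocks n + 1) ∣ n_j ≠ 0`. [folklore] -/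
theorem cfg_exists_dvd_waveBlocks {n : Fin 3 → ℤ} (hn : n ≠ 0) :
    ∃ j, n j ≠ 0 ∧ ((waveBlocks n + 1 : ℕ) : ℤ) ∣ n j := by
  obtain ⟨j, -, hj⟩ := Finset.exists_mem_eq_sup (Finset.univ : Finset (Fin 3)) Finset.univ_nonempty
    fun j => (n j).natAbs
  have hsup : supIdx n = (n j).natAbs := hj
  have hj0 : (n j).natAbs ≠ 0 := by
    rw [← hsup]; exact Nat.one_le_iff_ne_zero.1 (one_le_supIdx hn)
  have hw : waveBlocks n + 1 = (n j).natAbs := by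
    unfold waveBlocks
    rw [hsup]
    exact Nat.sub_add_cancel (Nat.one_le_iff_ne_zero.2 hj0)
  refine ⟨j, Int.natAbs_ne_zero.1 hj0, ?_⟩
  rw [hw]
  exact Int.natAbs_dvd.2 dvd_rfl

/-- Commensurability at the WAVELENGTH tiling: for `n ≠ 0` the plane wave `e^{ik·y}` integrates to zero
over every cube of side `L/‖n‖_∞`. [folklore] -/
theorem cfg_setIntegral_cubeSet_phase_waveBlocks (hL : 0 < L) {n : Fin 3 → ℤ} (hn : n ≠ 0)
    (Q : Fin 3 → Fin (waveBlocks n + 1)) : ∫ y in cubeSet L (waveBlocks n) Q, phase L n y = 0 := by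
  obtain ⟨j, hj, hdvd⟩ := cfg_exists_dvd_waveBlocks hn
  exact cfg_setIntegral_cubeSet_phase_eq_zero hL hj hdvd Q

/-! ### The free gas: `ψ ≡ L^{-3/2}`, `β = 0`, the cube charges vanish -/

/-- At `v = 0` the conditional amplitude of an exact minimiser is the constant `L^{-3/2}` on the cell
(`Φ` is constant on the cell, `L³ψ² = 1`, `ψ > 0`). [folklore] -/
theorem cfg_fibrePsi_of_free (hL : 0 < L) (Φ : PeriodicTrialState (m + 1) L)
    (hE : periodicEnergy 0 Φ = periodicGroundStateEnergy 0 (m + 1) L) (hΦ : ∀ X, Φ.ψ X ≠ 0)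
    {Y : Config (m + 1)} (hY : Y ∈ cellN (m + 1) L) : fibrePsi Φ Y = (Real.sqrt (L ^ 3))⁻¹ := by
  obtain ⟨c, hc⟩ := exists_eqOn_const_of_freeMinimiser hL Φ hE
  have h1 : L ^ 3 * fibrePsi Φ Y ^ 2 = 1 := condDensity_of_eqOn_const hL Φ hc hY
  have hL3 : 0 < L ^ 3 := by positivity
  have h2 : fibrePsi Φ Y ^ 2 = (Real.sqrt (L ^ 3))⁻¹ ^ 2 := by
    rw [inv_pow, Real.sq_sqrt hL3.le]
    exact (inv_eq_of_mul_eq_one_right h1).symm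
  exact (sq_eq_sq₀ (fibrePsi_pos hL Φ hΦ Y).le (by positivity)).1 h2

/-- At `v = 0` the mode `β = ∫_cell e^{ik·y}ψ dy = L^{-3/2}∫_cell e^{ik·y} dy` of an exact minimiser
vanishes on the cell for `n ≠ 0`. [folklore] -/
theorem cfg_fibreBeta_eq_zero_of_free (hL : 0 < L) {n : Fin 3 → ℤ} (hn : n ≠ 0)
    (Φ : PeriodicTrialState (m + 1) L) (hE : periodicEnergy 0 Φ = periodicGroundStateEnergy 0 (m + 1) L)
    (hΦ : ∀ X, Φ.ψ X ≠ 0) {X : Config (m + 1)} (hX : X ∈ cellN (m + 1) L) : fibreBeta n Φ X = 0 := by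
  have h : EqOn (fun y => phase L n y * (fibrePsi Φ (Function.update X 0 y) : ℂ))
      (fun y => phase L n y * (((Real.sqrt (L ^ 3))⁻¹ : ℝ) : ℂ)) (cell L) := fun y hy => by
    simp only [cfg_fibrePsi_of_free hL Φ hE hΦ (update_mem_cellN hX hy)]
  unfold fibreBeta
  rw [setIntegral_congr_fun (measurableSet_cell L) h, integral_mul_const]
  simp_rw [phase_eq_cellWave]
  rw [integral_cell_cellWave_eq_zero hL hn, zero_mul]

/-- On the fibre through a cell configuration the free charge is `q(y) = L⁻³e^{ik·y}`. [folklore] -/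
theorem cfg_cruxCharge_update_of_free (hL : 0 < L) {n : Fin 3 → ℤ} (hn : n ≠ 0)
    (Φ : PeriodicTrialState (m + 1) L) (hE : periodicEnergy 0 Φ = periodicGroundStateEnergy 0 (m + 1) L)
    (hΦ : ∀ X, Φ.ψ X ≠ 0) {X : Config (m + 1)} (hX : X ∈ cellN (m + 1) L) {y : Space}
    (hy : y ∈ cell L) :
    cruxCharge n Φ (Function.update X 0 y) =
      (((Real.sqrt (L ^ 3))⁻¹ * (Real.sqrt (L ^ 3))⁻¹ : ℝ) : ℂ) * phase L n y := by
  have hXy := update_mem_cellN hX hy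
  rw [cruxCharge, Function.update_self, cfg_fibrePsi_of_free hL Φ hE hΦ hXy,
    cfg_fibreBeta_eq_zero_of_free hL hn Φ hE hΦ hXy]
  push_cast
  ring

/-- At `v = 0` every cube of the wavelength tiling carries zero total charge on the fibres through the
cell: `c_Q = L⁻³∫_Q e^{ik·y} dy = 0` (commensurability). [folklore] -/
theorem cfg_cubeChargeOf_eq_zero_of_free (hL : 0 < L) {n : Fin 3 → ℤ} (hn : n ≠ 0)
    (Φ : PeriodicTrialState (m + 1) L) (hE : periodicEnergy 0 Φ = periodicGroundStateEnergy 0 (m + 1) L)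
    (hΦ : ∀ X, Φ.ψ X ≠ 0) {X : Config (m + 1)} (hX : X ∈ cellN (m + 1) L)
    (Q : Fin 3 → Fin (waveBlocks n + 1)) : cubeChargeOf L (waveBlocks n) (cruxCharge n Φ) Q X = 0 := by
  have h : EqOn (fun y => cruxCharge n Φ (Function.update X 0 y))
      (fun y => (((Real.sqrt (L ^ 3))⁻¹ * (Real.sqrt (L ^ 3))⁻¹ : ℝ) : ℂ) * phase L n y)
      (cubeSet L (waveBlocks n) Q) := fun y hy =>
    cfg_cruxCharge_update_of_free hL hn Φ hE hΦ hX (cubeSet_subset_cell hL Q hy)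
  unfold cubeChargeOf
  rw [setIntegral_congr_fun (measurableSet_cubeSet L _ Q) h, integral_const_mul,
    cfg_setIntegral_cubeSet_phase_waveBlocks hL hn Q, mul_zero]

/-! ### The free-gas instance of the coarse beat charge -/

/-- **THE FREE-GAS INSTANCE OF THE COARSE BEAT CHARGE.** At `v = 0`, for an exact zero-free minimiser
`Φ`, a mode `n ≠ 0` and a cell configuration `X`, the coarse beat charge of the wavelength tiling
vanishes: `q_c(X) = ψ(X)²·c_Q/μ_Q = 0`, because every cube charge `c_Q = L⁻³∫_Q e^{ik·y} dy` vanishes on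
the commensurate cubes of side `L/‖n‖_∞` (`ψ ≡ L^{-3/2}`, `β = 0`). [folklore] -/
theorem coarseOf_cruxCharge_eq_zero_of_free (hL : 0 < L) {n : Fin 3 → ℤ} (hn : n ≠ 0)
    (Φ : PeriodicTrialState (m + 1) L) (hE : periodicEnergy 0 Φ = periodicGroundStateEnergy 0 (m + 1) L)
    (hΦ : ∀ X, Φ.ψ X ≠ 0) {X : Config (m + 1)} (hX : X ∈ cellN (m + 1) L) :
    coarseOf L (waveBlocks n) Φ (cruxCharge n Φ) X = 0 := by
  unfold coarseOf
  rw [cfg_cubeChargeOf_eq_zero_of_free hL hn Φ hE hΦ hX, zero_div, mul_zero]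

/-- **Corollary: at `v = 0` the coarse beat charge has dual bound `0`.** The integrand of the pairing
`∫_{cellN} q_c η` vanishes on `cellN` (`coarseOf_cruxCharge_eq_zero_of_free`), so the pairing is `0`
for every test function `η`. [folklore] -/
theorem hasDualBound_coarse_free (hL : 0 < L) {n : Fin 3 → ℤ} (hn : n ≠ 0)
    (Φ : PeriodicTrialState (m + 1) L) (hE : periodicEnergy 0 Φ = periodicGroundStateEnergy 0 (m + 1) L)
    (hΦ : ∀ X, Φ.ψ X ≠ 0) :
    HasDualBound Φ (coarseOf L (waveBlocks n) Φ (cruxCharge n Φ)) 0 := by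
  intro η _
  have h : EqOn (fun X => coarseOf L (waveBlocks n) Φ (cruxCharge n Φ) X * η X) (fun _ => 0)
      (cellN (m + 1) L) := fun X hX => by
    simp only [coarseOf_cruxCharge_eq_zero_of_free hL hn Φ hE hΦ hX, zero_mul]
  rw [setIntegral_congr_fun (measurableSet_cellN (m + 1) L) h, integral_zero, norm_zero]
  simp

end Summit.AtomisticToContinuum.BoseEinsteinCondensation.Cruxes.FibreConductance.ConditionalLawPoincare

end
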